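import Mathlib
import HarnessLib
import Summits.HubbardSuperconductivity.HubbardSuperconductivity.Theorems.KLProgrammePolarRayCoareaJacobianFrame
import Summits.HubbardSuperconductivity.HubbardSuperconductivity.Theorems.KLProgrammeLatticePlanarRiemann

/-!
# Route `KLProgramme` — K3 ENGINE (stmt-HubbardSuperconductivity-20437 `KLRegimeEngineV17F2`), row (c) binder #8 `RS` row / cure (C′), GEO input:
# ODDNESS CANCELLATION ON THE FRAME'S CURVE — the planar integral of a LEVEL-BUILT integrand with a profile ODD in the level is `O(ē²)`
# (cell gate-hubbard-kl, seat gate-hubbard-kl-p1b g21; the SMOOTH twin of the k3c2-p2 lineage's count bricks O2/O3 of `CURE-C-PRIME-DESIGN.md`)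

WHY.  Cure (C′) of located #22 routes the localised tree × `z_S(iω − e_K)` piece of the Σ-triple through Matsubara parity (`klod_*`, O1): what is
left is a function of the momentum through the frame band ONLY, `k ↦ F(e_K(k))`, with `F` ODD in the level.  On the lattice the k3c2 bricks bound
`Σ_k F(e_K(k))` by the two-sided shell-count ASYMMETRY (O2 `klol_*`, O3).  In the continuum the same cancellation is the coarea on the frame's
curve: `∫ d²k F(e_K(k)) = ∫ dθ ∫_{−ē}^{ē} 𝒥_E(θ,e) F(e) de = ∫ dθ ∫_0^{ē} (𝒥_E(θ,e) − 𝒥_E(θ,−e)) F(e) de`, and the level-set Jacobian is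
e-Lipschitz (`klrj_jacobian_lipschitz`), so the whole integral is `≤ 2π · 2L_𝒥 · sup‖F‖ · ē²` — quadratic in the shell width, with a constant that is
a function of `(Dt_min, κ₁, κ₂)` only (under `FrameOK`: of `(R, U, c, B.Dtmin)` only), uniform in the scale.

* §1 `klro_intervalIntegral_odd_smul_norm_le` — the 1D core: `J` `L`-Lipschitz on `[−ē, ē]`, `H` odd with `‖H‖ ≤ C` there ⇒
  `‖∫_{−ē}^{ē} J e • H e de‖ ≤ 2·L·C·ē²` (reflection `e ↦ −e`: `2∫ J•H = ∫ (J(e) − J(−e)) • H(e)`);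
* §2 `klro_integral_oddLevel_norm_le` — under EXACTLY the `section Frame` hypotheses of `…PolarRayCoareaFrame` (p4's `B : BandBounds a b`, `δ ∈ C¹`,
  `|δ| ≤ κ₀`, `‖Dδ‖ ≤ κ₁ < Dt_min`, margin window) plus the radial `κ₂` of `…PolarRayCoareaJacobian`: for `h` continuous, compactly supported,
  supported in the open square and the tube `|ε₀ + δ − μ| < ē`, RADIAL LEVEL-BUILT `h(t·(cos θ, sin θ)) = H θ ((ε₀ + δ − μ)(t·dir θ))` with
  `H θ (−e) = −H θ e` and `‖H θ e‖ ≤ C` on `[−ē, ē]`: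
  **`‖∫ h‖ ≤ 2π · (2 · (1/d² + π√2(2+κ₂)/d³) · C · ē²)`**, `d = Dt_min − κ₁`;
* §3 `klro_integral_oddLevel_norm_le_of_frameOK` — the frame instance `δ_K = frameShift K ∘ toLp` under `FrameOK R U (nScales β) μ K` in the KL
  regime (`κ₀ = κ₁ = κ₂ := 4A`, `A = 2·Gfr 0·|U| + 2·Gfr 1·U² + Gfr 2·c/log 4`, via `klrk_frameShift_radial_lipschitz`, `frameShift_toLp_small`);
* §4 `klro_latticeAverage_norm_le_of_planar` — the LATTICE twin (one Matsubara frequency): for the continuous doubly `2π`-periodic `K`-Lipschitz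
  extension `F` of an `h` vanishing off the closed square, `‖L⁻²·Σ_k F(2πk/L)‖ ≤ 2πK/L + (2π)⁻²·‖∫ h‖` (Riemann passage
  `klfl_latticeAverage_sub_planar_integral_norm_le`, p489318); the Matsubara-summed passage is `klfl_matsubara_latticeAverage_norm_le(_scale)`.

Tools, all landed: `klrf_integral_eq_frame_level_coords_radial` (coarea on the frame's curve), `klrj_jacobian_lipschitz`, `klrf_continuousAt_level`,
`klrf_continuousOn_invPertDt`, `perturbedFermiRadius_mem_Ioo`, `isBandFermiRadius_perturbedFermiRadius`.  Pure analysis on the tree's objects; no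
definitions; nothing about the effective action, any registered row of 20437, K3, U₀, the window or superconductivity is asserted.
References: BGM 2006 §2.5 (2.56b)–(2.56e) (level coordinates and the oddness of the `e`-integration) [cite: BenfattoGiulianiMastropietro2006];
HOME/hubbard-kl-k3c2-p2/g30/CURE-C-PRIME-DESIGN.md §2 row 1, HOME/hubbard-kl-k3c1-p1/g25/C-PRIME-TYPING.md §3.
-/

noncomputable section

namespace Summit.HubbardSuperconductivity.HubbardSuperconductivity.Theorems.KLRegimeSplit

set_option linter.dupNamespace false -- summit = problem name (single-conjunct summit), D-0017

open Real Set MeasureTheory intervalIntegral Literature.MathematicalPhysics.QuantumLattice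
open Literature.MathematicalPhysics.QuantumLattice.BandSectorCounting
open Summit.HubbardSuperconductivity.HubbardSuperconductivity.Theorems.PerturbedFermiCurve
open Summit.HubbardSuperconductivity.HubbardSuperconductivity.Theorems.DispersionFlow

/-! ## §1 The one-dimensional core: an odd profile against a Lipschitz weight on a symmetric interval -/

/-- **Odd profile × Lipschitz weight on `[−ē, ē]`.**  If `J : ℝ → ℝ` is `L`-Lipschitz on `[−ē, ē]` (`0 ≤ L`), `H` is ODD with `‖H e‖ ≤ C` on
`[−ē, ē]`, and `e ↦ J e • H e` is interval-integrable, then `‖∫_{−ē}^{ē} J e • H e de‖ ≤ 2·L·C·ē²`: reflecting `e ↦ −e`,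
`2·∫ J•H = ∫ (J(e) − J(−e)) • H(e)` and `|J(e) − J(−e)| ≤ 2L|e| ≤ 2Lē`. -/
theorem klro_intervalIntegral_odd_smul_norm_le {E' : Type*} [NormedAddCommGroup E'] [NormedSpace ℝ E']
    {J : ℝ → ℝ} {H : ℝ → E'} {ē L C : ℝ} (hē : 0 ≤ ē) (hL : 0 ≤ L)
    (hJ : ∀ e ∈ Icc (-ē) ē, ∀ e' ∈ Icc (-ē) ē, |J e - J e'| ≤ L * |e - e'|)
    (hodd : ∀ e, H (-e) = -H e) (hC : ∀ e ∈ Icc (-ē) ē, ‖H e‖ ≤ C)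
    (hint : IntervalIntegrable (fun e => J e • H e) volume (-ē) ē) :
    ‖∫ e in (-ē)..ē, J e • H e‖ ≤ 2 * L * C * ē ^ 2 := by
  set f : ℝ → E' := fun e => J e • H e with hf
  -- the reflected integrand has the same integral and is integrable
  have hneg : (∫ e in (-ē)..ē, f (-e)) = ∫ e in (-ē)..ē, f e := by
    rw [intervalIntegral.integral_comp_neg]
    simp only [neg_neg]
  have hint' : IntervalIntegrable (fun e => f (-e)) volume (-ē) ē := by
    have h1 := (IntervalIntegrable.iff_comp_neg (f := f) (a := -ē) (b := ē)).mp hint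
    rw [neg_neg] at h1
    exact h1.symm
  have h2 : (2 : ℝ) • (∫ e in (-ē)..ē, f e) = ∫ e in (-ē)..ē, (f e + f (-e)) := by
    rw [intervalIntegral.integral_add hint hint', hneg, two_smul]
  -- pointwise bound of the symmetrised integrand on `Ι (−ē) ē = Ioc (−ē) ē`
  have hpt : ∀ x ∈ Set.uIoc (-ē) ē, ‖f x + f (-x)‖ ≤ 2 * L * ē * C := by
    intro x hx
    rw [Set.uIoc_of_le (by linarith)] at hx
    have hx' : x ∈ Icc (-ē) ē := ⟨hx.1.le, hx.2⟩
    have hnx : -x ∈ Icc (-ē) ē := ⟨by linarith [hx'.2], by linarith [hx'.1]⟩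
    have hfx : f x + f (-x) = (J x - J (-x)) • H x := by
      simp only [hf, hodd, smul_neg, sub_smul]
      abel
    rw [hfx, norm_smul, Real.norm_eq_abs]
    have habs : |x - -x| ≤ 2 * ē := by
      rw [sub_neg_eq_add, ← two_mul, abs_mul, abs_two]
      have : |x| ≤ ē := abs_le.mpr ⟨hx'.1, hx'.2⟩
      linarith
    have h1 : |J x - J (-x)| ≤ 2 * L * ē :=
      calc |J x - J (-x)| ≤ L * |x - -x| := hJ x hx' (-x) hnx
        _ ≤ L * (2 * ē) := mul_le_mul_of_nonneg_left habs hL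
        _ = 2 * L * ē := by ring
    calc |J x - J (-x)| * ‖H x‖ ≤ (2 * L * ē) * C := mul_le_mul h1 (hC x hx') (norm_nonneg _) (by positivity)
      _ = 2 * L * ē * C := by ring
  have hI := intervalIntegral.norm_integral_le_of_norm_le_const hpt
  rw [← h2, norm_smul, Real.norm_eq_abs, abs_two] at hI
  have hee : |ē - -ē| = 2 * ē := by
    rw [sub_neg_eq_add, ← two_mul, abs_of_nonneg (by positivity)]
  rw [hee] at hI
  nlinarith [hI, norm_nonneg (∫ e in (-ē)..ē, f e)]

/-! ## §2 The planar theorem on the frame's curve -/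

section Frame

variable {a b : ℝ} (B : BandBounds a b) {δ : (Fin 2 → ℝ) → ℝ} (hδ1 : ContDiff ℝ 1 δ) {κ₀ κ₁ : ℝ}
  (hδ : ∀ k : Fin 2 → ℝ, (∀ i, |k i| ≤ π) → |δ k| ≤ κ₀)
  (hκ : ∀ k : Fin 2 → ℝ, (∀ i, |k i| ≤ π) → ‖fderiv ℝ δ k‖ ≤ κ₁) (hκ₁ : κ₁ < B.Dtmin)

include B hδ1 hδ hκ hκ₁ in
/-- **ODDNESS CANCELLATION ON THE FRAME'S CURVE.**  Under the `…PolarRayCoareaFrame` hypotheses (p4's `B : BandBounds a b`, `δ ∈ C¹`, `|δ| ≤ κ₀`,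
`‖Dδ‖ ≤ κ₁ < Dt_min`) and a radial Lipschitz constant `κ₂` of `t ↦ Dδ(t·dir θ)[dir θ]` on every ray segment: for `h : ℝ × ℝ → E` continuous with
compact support, supported in the open square `(−π,π)²` and in the tube `|ε₀ + δ − μ| < ē` (`0 ≤ ē`, margin window `a < μ − ē − κ₀`, `μ + ē + κ₀ < b`),
RADIAL LEVEL-BUILT — `h(t cos θ, t sin θ) = H θ ((ε₀ + δ)(t·dir θ) − μ)` for `t > 0` — with a profile ODD IN THE LEVEL, `H θ (−e) = −H θ e`, and bounded,
`‖H θ e‖ ≤ C` for `θ ∈ (−π,π)`, `e ∈ [−ē, ē]`: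
`‖∫ h‖ ≤ 2π · (2 · (1/d² + π√2·(2+κ₂)/d³) · C · ē²)`, `d = Dt_min − κ₁`.
(Coarea `klrf_integral_eq_frame_level_coords_radial`, then §1 per angle with the e-Lipschitz Jacobian `klrj_jacobian_lipschitz`.) -/
theorem klro_integral_oddLevel_norm_le {E' : Type*} [NormedAddCommGroup E'] [NormedSpace ℝ E'] {κ₂ : ℝ} (hκ₂ : 0 ≤ κ₂)
    (hD2 : ∀ θ s t : ℝ, s ∈ Icc 0 (π / ‖dir θ‖) → t ∈ Icc 0 (π / ‖dir θ‖) →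
      |fderiv ℝ δ (s • dir θ) (dir θ) - fderiv ℝ δ (t • dir θ) (dir θ)| ≤ κ₂ * |s - t|)
    {h : ℝ × ℝ → E'} (hc : Continuous h) (hcs : HasCompactSupport h) {μ ē : ℝ} (hē : 0 ≤ ē)
    (hlo : a < μ - ē - κ₀) (hhi : μ + ē + κ₀ < b)
    (hsupp : ∀ p : ℝ × ℝ, h p ≠ 0 → |p.1| < π ∧ |p.2| < π ∧ |sqDispersion ![p.1, p.2] + δ ![p.1, p.2] - μ| < ē)
    {H : ℝ → ℝ → E'}
    (hfac : ∀ θ ∈ Ioo (-π) π, ∀ t, 0 < t → h (t * Real.cos θ, t * Real.sin θ) = H θ (rayDispersion (θ, t) + δ (t • dir θ) - μ))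
    (hodd : ∀ θ e, H θ (-e) = -H θ e) {C : ℝ} (hC : ∀ θ ∈ Ioo (-π) π, ∀ e ∈ Icc (-ē) ē, ‖H θ e‖ ≤ C) :
    ‖∫ p, h p‖ ≤ 2 * π * (2 * (1 / (B.Dtmin - κ₁) ^ 2 + π * Real.sqrt 2 * (2 + κ₂) / (B.Dtmin - κ₁) ^ 3) * C * ē ^ 2) := by
  have hδc : Continuous δ := hδ1.continuous
  have hd : 0 < B.Dtmin - κ₁ := by linarith
  have hL : 0 ≤ 1 / (B.Dtmin - κ₁) ^ 2 + π * Real.sqrt 2 * (2 + κ₂) / (B.Dtmin - κ₁) ^ 3 := by positivity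
  rw [klrf_integral_eq_frame_level_coords_radial B hδ1 hδ hκ hκ₁ hc hcs hē hlo hhi hsupp hfac]
  -- per-angle bound by §1
  have hθ : ∀ θ ∈ Ioo (-π) π, ‖∫ e in (-ē)..ē,
      (perturbedFermiRadius δ (μ + e) θ *
          (rayDispersionDt θ (perturbedFermiRadius δ (μ + e) θ) +
            fderiv ℝ δ (perturbedFermiRadius δ (μ + e) θ • dir θ) (dir θ))⁻¹) • H θ e‖ ≤
      2 * (1 / (B.Dtmin - κ₁) ^ 2 + π * Real.sqrt 2 * (2 + κ₂) / (B.Dtmin - κ₁) ^ 3) * C * ē ^ 2 := by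
    intro θ hθ
    refine klro_intervalIntegral_odd_smul_norm_le hē hL ?_ (hodd θ) (hC θ hθ) ?_
    · intro e he e' he'
      have hlip := klrj_jacobian_lipschitz B hδ1 hδ hκ hκ₁ hκ₂ (hD2 θ) (ν := μ + e) (ν' := μ + e')
        (by linarith [he.1]) (by linarith [he.2]) (by linarith [he'.1]) (by linarith [he'.2])
      rwa [add_sub_add_left_eq_sub] at hlip
    · -- integrability: the integrand agrees on `[−ē, ē]` with the continuous level integrand of `h`
      have hu_on : ContinuousOn (fun e : ℝ => perturbedFermiRadius δ (μ + e) θ) (Icc (-ē) ē) := by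
        intro e he
        have hA : ContinuousAt (fun ν : ℝ => perturbedFermiRadius δ ν θ) (μ + e) :=
          klrf_continuousAt_level B hδ1 hδ hκ hκ₁ (by linarith [he.1]) (by linarith [he.2]) θ
        have hB : Continuous (fun e : ℝ => μ + e) := by fun_prop
        exact (ContinuousAt.comp (f := fun e : ℝ => μ + e) (x := e) hA hB.continuousAt).continuousWithinAt
      have hinv := klrf_continuousOn_invPertDt B hδ1 hδ hκ hκ₁ hlo hhi θ
      have hpt : ContinuousOn (fun e : ℝ => ((perturbedFermiRadius δ (μ + e) θ * Real.cos θ,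
          perturbedFermiRadius δ (μ + e) θ * Real.sin θ) : ℝ × ℝ)) (Icc (-ē) ē) :=
        (hu_on.mul continuousOn_const).prodMk (hu_on.mul continuousOn_const)
      have hcont : ContinuousOn (fun e : ℝ => (perturbedFermiRadius δ (μ + e) θ *
            (rayDispersionDt θ (perturbedFermiRadius δ (μ + e) θ) +
              fderiv ℝ δ (perturbedFermiRadius δ (μ + e) θ • dir θ) (dir θ))⁻¹) •
          h (perturbedFermiRadius δ (μ + e) θ * Real.cos θ, perturbedFermiRadius δ (μ + e) θ * Real.sin θ)) (Icc (-ē) ē) :=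
        (hu_on.mul hinv).smul (hc.comp_continuousOn hpt)
      have hii := hcont.intervalIntegrable_of_Icc (μ := volume) (by linarith : -ē ≤ ē)
      refine (intervalIntegrable_congr fun e he => ?_).mp hii
      rw [Set.uIoc_of_le (by linarith)] at he
      have he' : e ∈ Icc (-ē) ē := ⟨he.1.le, he.2⟩
      have hupos := (perturbedFermiRadius_mem_Ioo B hδc hδ (μ := μ + e) (by linarith [he'.1]) (by linarith [he'.2]) θ).1
      have hlev := (isBandFermiRadius_perturbedFermiRadius B hδc hδ (μ := μ + e)
        (by linarith [he'.1]) (by linarith [he'.2]) θ).2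
      simp only [hfac θ hθ _ hupos]
      congr 2
      linarith
  -- the angular integral
  have hvol : volume (Ioo (-π) π) < ⊤ := by simp [Real.volume_Ioo]
  have hout := norm_setIntegral_le_of_norm_le_const hvol hθ
  rw [Real.volume_real_Ioo_of_le (by linarith [Real.pi_pos])] at hout
  calc _ ≤ 2 * (1 / (B.Dtmin - κ₁) ^ 2 + π * Real.sqrt 2 * (2 + κ₂) / (B.Dtmin - κ₁) ^ 3) * C * ē ^ 2 * (π - -π) := hout
    _ = 2 * π * (2 * (1 / (B.Dtmin - κ₁) ^ 2 + π * Real.sqrt 2 * (2 + κ₂) / (B.Dtmin - κ₁) ^ 3) * C * ē ^ 2) := by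
        ring

end Frame

/-! ## §3 The frame instance under `FrameOK` in the KL regime -/

section FrameOK

variable {R : RenConsts} {U c β μ : ℝ} {K : TrigPolyC4v} {a b : ℝ} (B : BandBounds a b)

/-- **ODDNESS CANCELLATION ON AN ADMISSIBLE FRAME'S CURVE** (`klro_integral_oddLevel_norm_le` with every p4 input discharged from `FrameOK`): in the KL
regime `klBetaMin ≤ β ≤ e^{c/U²}` with `FrameOK R U (nScales β) μ K`, `A := 2·Gfr 0·|U| + 2·Gfr 1·U² + Gfr 2·c/log 4`, `4A < B.Dtmin`, margin window
`a < μ − ē − 4A`, `μ + ē + 4A < b`: for `h` continuous, compactly supported, supported in the open square and in the tube `|ε₀ + δ_K − μ| < ē`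
(`δ_K = frameShift K ∘ toLp`), radial level-built with an ODD bounded profile (`H θ (−e) = −H θ e`, `‖H θ e‖ ≤ C` on `[−ē, ē]`):
`‖∫ h‖ ≤ 2π · (2 · (1/d² + π√2·(2 + 4A)/d³) · C · ē²)`, `d = B.Dtmin − 4A` — a constant that is a function of `(R, U, c, B.Dtmin)` only. -/
theorem klro_integral_oddLevel_norm_le_of_frameOK {E' : Type*} [NormedAddCommGroup E'] [NormedSpace ℝ E']
    (hR : ∀ j, 0 ≤ R.Gfr j) (hc : 0 ≤ c) (hβmin : klBetaMin ≤ β) (hβc : β ≤ Real.exp (c / U ^ 2))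
    (hK : FrameOK R U (nScales β) μ K)
    (hA : 4 * (2 * R.Gfr 0 * |U| + 2 * R.Gfr 1 * U ^ 2 + R.Gfr 2 * (c / Real.log 4)) < B.Dtmin)
    {h : ℝ × ℝ → E'} (hcont : Continuous h) (hcs : HasCompactSupport h) {ē : ℝ} (hē : 0 ≤ ē)
    (hlo : a < μ - ē - 4 * (2 * R.Gfr 0 * |U| + 2 * R.Gfr 1 * U ^ 2 + R.Gfr 2 * (c / Real.log 4)))
    (hhi : μ + ē + 4 * (2 * R.Gfr 0 * |U| + 2 * R.Gfr 1 * U ^ 2 + R.Gfr 2 * (c / Real.log 4)) < b)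
    (hsupp : ∀ p : ℝ × ℝ, h p ≠ 0 → |p.1| < π ∧ |p.2| < π ∧
      |sqDispersion ![p.1, p.2] + frameShift K (WithLp.toLp 2 ![p.1, p.2]) - μ| < ē)
    {H : ℝ → ℝ → E'}
    (hfac : ∀ θ ∈ Ioo (-π) π, ∀ t, 0 < t →
      h (t * Real.cos θ, t * Real.sin θ) = H θ (rayDispersion (θ, t) + frameShift K (WithLp.toLp 2 (t • dir θ)) - μ))
    (hodd : ∀ θ e, H θ (-e) = -H θ e) {C : ℝ} (hC : ∀ θ ∈ Ioo (-π) π, ∀ e ∈ Icc (-ē) ē, ‖H θ e‖ ≤ C) :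
    ‖∫ p, h p‖ ≤ 2 * π * (2 * (1 / (B.Dtmin - 4 * (2 * R.Gfr 0 * |U| + 2 * R.Gfr 1 * U ^ 2 + R.Gfr 2 * (c / Real.log 4))) ^ 2 +
        π * Real.sqrt 2 * (2 + 4 * (2 * R.Gfr 0 * |U| + 2 * R.Gfr 1 * U ^ 2 + R.Gfr 2 * (c / Real.log 4))) /
          (B.Dtmin - 4 * (2 * R.Gfr 0 * |U| + 2 * R.Gfr 1 * U ^ 2 + R.Gfr 2 * (c / Real.log 4))) ^ 3) * C * ē ^ 2) := by
  have hAb := klrk_frame_C2_bound hR hc hβmin hβc hK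
  have hsm := frameShift_toLp_small hAb le_rfl
  have hA0 : 0 ≤ 2 * R.Gfr 0 * |U| + 2 * R.Gfr 1 * U ^ 2 + R.Gfr 2 * (c / Real.log 4) :=
    (norm_nonneg _).trans (hAb 0 0 (by norm_num))
  exact klro_integral_oddLevel_norm_le B (contDiff_frameShift_toLp K) (fun k _ => hsm.1 k) (fun k _ => hsm.2.1 k) hA
    (by positivity) (fun θ s t _ _ => klrk_frameShift_radial_lipschitz hR hc hβmin hβc hK θ s t)
    hcont hcs hē hlo hhi hsupp hfac hodd hC

end FrameOK

/-! ## §4 The lattice twin (one frequency): torus average ≤ Riemann term + planar bound -/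

section Lattice

open Literature.Probability.LatticeModels
open scoped NNReal

variable {E' : Type*} [NormedAddCommGroup E'] [NormedSpace ℝ E'] [CompleteSpace E']

/-- **Lattice twin.**  If `F : ℝ × ℝ → E` is continuous, doubly `2π`-periodic and `K`-Lipschitz, agrees on the closed square `[−π,π]²` with an `h` that
vanishes off it, and `‖∫ h‖ ≤ D`, then the torus average obeys `‖L⁻²·Σ_{k ∈ (ℤ/L)²} F(2πk/L)‖ ≤ 2πK/L + (2π)⁻²·D` — so §2/§3 transport to the
engine's momentum sums (`D = 2π·(2L_𝒥·C·ē²)`), the Riemann term being the usual `1/L` volume share. -/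
theorem klro_latticeAverage_norm_le_of_planar {F h : ℝ × ℝ → E'} (hF : Continuous F)
    (h1 : ∀ x y, F (x + 2 * π, y) = F (x, y)) (h2 : ∀ x y, F (x, y + 2 * π) = F (x, y))
    {K : ℝ≥0} (hlip : ∀ p q : ℝ × ℝ, ‖F p - F q‖ ≤ K * dist p q)
    (hFh : ∀ p ∈ Icc (-π) π ×ˢ Icc (-π) π, F p = h p) (hh0 : ∀ p ∉ Icc (-π) π ×ˢ Icc (-π) π, h p = 0)
    {D : ℝ} (hD : ‖∫ p, h p‖ ≤ D) (L : ℕ) [NeZero L] :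
    ‖((L ^ 2 : ℕ) : ℝ)⁻¹ • ∑ k : TorusSite 2 L, F (latticeMomentum L k 0, latticeMomentum L k 1)‖ ≤
      2 * π * K / L + ((2 * π) ^ 2)⁻¹ * D := by
  set A := ((L ^ 2 : ℕ) : ℝ)⁻¹ • ∑ k : TorusSite 2 L, F (latticeMomentum L k 0, latticeMomentum L k 1) with hA
  set I : E' := ((2 * π) ^ 2)⁻¹ • ∫ p, h p with hI
  have hAI : ‖A - I‖ ≤ 2 * π * K / L := klfl_latticeAverage_sub_planar_integral_norm_le hF h1 h2 hlip hFh hh0 L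
  have hIn : ‖I‖ ≤ ((2 * π) ^ 2)⁻¹ * D := by
    rw [hI, norm_smul, norm_inv, norm_pow, Real.norm_eq_abs, abs_of_pos (by positivity)]
    exact mul_le_mul_of_nonneg_left hD (by positivity)
  calc ‖A‖ = ‖(A - I) + I‖ := by rw [sub_add_cancel]
    _ ≤ ‖A - I‖ + ‖I‖ := norm_add_le _ _
    _ ≤ 2 * π * K / L + ((2 * π) ^ 2)⁻¹ * D := add_le_add hAI hIn

end Lattice

end Summit.HubbardSuperconductivity.HubbardSuperconductivity.Theorems.KLRegimeSplit

end
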